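import Summits.HodgeConjecture.HodgeConjecture.Theorems.F0P6aRGDAssemblyDefs
import Literature.AlgebraicGeometry.AbelianSchemes.FrobeniusKernelLawBlockAssembly
import Literature.RingTheory.DedekindDomain.CRTIdempotentFamily
import HarnessLib

/-!
# `F0P6aRoofFrobKernelLawAssembly` — ★ RE-HOME of the crux workfile `Lines/F0_P6a_RoofFrobKernelLawAssembly.lean` (tree sha16 cf7bc338fa8bbf68, 352 l., 10 declaration commands, code-`sorry`-free)

This `Theorems/` module is the TREE BYTES of that workfile with the NAMESPACE KEPT, so every fully-qualified name is UNCHANGED; only this module docstring is re-headed,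
the `Lines` imports are switched to their ★ re-homed twins — `Lines.F0_P6a_RGDAssembly` → ★ `Theorems.F0P6aRGDAssemblyDefs` — and the audit carrier `LibrarySuggestionsDenyListCruxes` is dropped (it stays in the `Lines/` shim).
Why a re-home: a `Theorems/` file cannot import a `Lines/` workfile (F0P6-ref1 o-6), and closing stmt-HodgeConjecture-24832 `--as proved --by <Theorems decl>` at rung 0 needs the
sorry-free `Lines` chain behind the gate (RE-HOME TABLE v1.7, LA7-plan (g7); PLAN «L3 cone RE-HOME» v1, LA3-plan (g5); LEAD F0P6-plan (g5) «M-140» (1)∕(4), 2026-09-02).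
One part (≤ 400 l.); this is the module the `Lines/` shim and consumers import.
After the chain is ★ the `Lines` workfile becomes a one-import SHIM of `F0P6aRoofFrobKernelLawAssembly` (a `Lines/` write, batched per cone on the LEAD՚s word), so no environment holds two copies (NO-CROSS-IMPORT).
It asserts nothing beyond what the workfile already proves.  HC_CM is proved only modulo the 7 printed citations (2 remaining: hLiu418 = stmt-HodgeConjecture-24832, h413 = stmt-HodgeConjecture-24833) until rung 0 closes; a re-home is count-neutral.

## Original module docstring (verbatim)
# F0 · P6a — LEAFLET `Lines/F0_P6a_RoofFrobKernelLawAssembly.lean` ED. 1: the (rL) FROBENIUS-KERNEL LAW of `Roof₀` AT `A_{red₀ y}` ASSEMBLED from per-block laws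
# (line L3 ROOF road, LA3-plan (g2) COV0 RULING (6) ∕ L3 CONE PLAN v1 «W3»; LA1-p03 (g3); [Liu2021] Prop. D.8 (3); [Shimura1998] §13.1 Thm. 1; [Neukirch1999] I (3.6))

`crux_decl: Summit.HodgeConjecture.HodgeConjecture.Theses.HCCMUnconditional.HLiu418`.  Cell `hodgecm-mathlib` (D-0151), «GO 500» half A; item stmt-HodgeConjecture-24832
(count-neutral; nothing registered; no socket statement touched).  EDITION 1 = LA1-p03 (g3) HOME pack v5 = v4 (code byte-identical to v3 9b81f667 — (R1) banal law boxed by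
LA3-r01 #20 at v1 —, namespace renamed after the leaflet, header retitled) RE-POINTED TO AN ABSTRACT TWIST IDEAL (LA3-p02 (g3) W5 `stub_ROOFGEO` junction census GAP-3: the
leaf binds an abstract `𝔞` (LEAD «M-54»), never `I.twistIdeal`): the heads take `(𝔞γ : Ideal (𝓞 F)) (hban : FrobKernelBanal₀ … 𝔞γ) (h𝔠 : 𝔠 * 𝔭_w = 𝔞γ) (hq : (p^f) ∈ 𝔠·𝔭_w·𝔭_{c•w})`
and the Frobenius-reading guard `(σ hσ γ hγ)` leaves them; the spine-instantiated forms (`𝔞γ := I.twistIdeal γ`, row 38, rows `twistNorm_spec`∕`twistNorm_frob`∕`twistIdeal_frob`)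
stay as the corollaries `hq_sch₀Of` ∕ `hL_sch₀Of_twistIdeal`; ALL budgets DEFAULT (measured; v1–v5 carried 400000∕800000 from the heavier v1 statements); writer = the L3 pen
LA3-plan (g2) on the LEAD heir's word.  THEOREMS ONLY; imports the SERVED spine
`Cruxes/HLiu418/Lines/F0_P6a_RGDAssembly` ED. 4 + ★ p848378∕p849786 `FrobeniusKernelLawBlockAssembly` + ★ p849638 `CRTIdempotentFamily` + HarnessLib (a `Theorems/` file may not
import `Cruxes/…/Lines`, gate `lint.import`, hence a `Lines/` leaflet).  Namespace `Summit.HodgeConjecture.HodgeConjecture.Cruxes.HLiu418.F0P6aRoofFrobKernelLawAssembly`.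
HC_CM is proved only modulo the 7 printed citations (2 remaining: hLiu418 = stmt-HodgeConjecture-24832, h413 = stmt-HodgeConjecture-24833) until rung 0 closes.

THE ROW.  In the all-`T` assembly of the Frobenius-kernel law (rL) of Defs `Roof₀` (★ p848378 `comp_relFrobeniusOver_eq_one_iff_of_torsion_blocks` at `A := sch₀Of 𝓜 w I.univ (red₀ y)`,
`q = p^f`, co-ideal `𝔠 = frobIdealOf 𝔞 w γ`, leg `q̄`), the `law` binder at a BANAL index `u ∣ p`, `u ∉ {w, c•w}`, reads: for every `q`-torsion `T`-point `x` fixed by `ι(e_u)` (the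
`u`-idempotent of the CRT family ★ `CRTIdempotentFamily.exists_crtIdempotentFamily_span_singleton`), `x ≫ F_q = 1 ↔ ∀ a ∈ 𝔠, x ≫ ι(a) ≫ q̄ = 1`.  It is ★ p848378 §4
`blockLaw_of_idealTorsionLaw` fed with: the `𝔭_u^n`-TORSION LAW «`x ≫ F_q = 1 ↔ ι(𝔞_γ) x = 1`» = a hypothesis `hban : FrobKernelBanal₀ … 𝔞γ` (the leaf's `(_hpin σ hσ γ hγ).2`
at `𝔞γ := 𝔞 γ`; spine row 38 `I.frobKernel_banal σ hσ γ hγ` at `𝔞γ := twistIdeal γ`; its `act₀Of … a x̄` tokens ARE `((I.act.baseChange ι_s).baseChange x̄.left).i a`, `rfl`), the absorption `𝔭_u^n · e_u ⊆ (q)` (CRT family), `𝔭_u^n ⊔ 𝔭 = ⊤` for the kernel bound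
`Ker q̄ ⊆ A[𝔭]` (§1: any `𝔭` supported on primes `≠ u`), and `𝔠 ⊔ 𝔭_u^n = 𝔞_γ ⊔ 𝔭_u^n` (§1: `𝔠·𝔭_w = 𝔞_γ`, `u ≠ w`).  The leg `q̄`, the bound `𝔭` and `𝔠` stay PARAMETERS
(LA3-p01's ROOF-LEGS v3 supplies `q̄`, the dealer rules `𝔭`), so this row is road-independent.

* §1 (Dedekind side conditions, generic `𝓞 F`): `sup_pow_asIdeal_eq_of_mul_asIdeal_eq` (`𝔠·𝔭_w = 𝔞 ⇒ 𝔠 ⊔ 𝔭_u^n = 𝔞 ⊔ 𝔭_u^n`, `u ≠ w`), `pow_asIdeal_sup_mul_eq_top`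
  (`𝔭_u^n ⊔ 𝔭_v^a·𝔭_{v′}^b = ⊤` for `u ∉ {v, v′}`), `natCast_mem_mul_asIdeal_mul_smul_asIdeal` (the `hq` numerology `n ∈ 𝔠·𝔭_w·𝔭_{g•w}`);
* §2 **`banalBlockLaw_sch₀Of`** — the `law` binder of ★ p848378 at a banal index, at `A_{red₀ y}`, from `hban : FrobKernelBanal₀ … 𝔞γ`; **`hq_of_norm_spec`** — the `hq` binder
  (`(p^f) ∈ 𝔠·𝔭_w·𝔭_{c•w}`) from the leaf's tokens `𝔠·𝔭_w = 𝔞γ`, `(𝔫γ) = 𝔞γ · c•𝔞γ`, `𝔫γ = p^f`, `𝔭_w ∣ 𝔞γ`; **`hq_sch₀Of`** — the same from rows `twistNorm_spec`∕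
  `twistNorm_frob`∕`twistIdeal_frob` at `𝔞γ := twistIdeal γ`;
* §3 **`hL_sch₀Of`** — THE ASSEMBLY AT x̄: the (rL) row on all `T`-points from `hban`, `h𝔠`, `hq`, the CRT datum, `hker` (kernel bound) and the two `p`-adic block laws `hlaw`;
  **`hL_sch₀Of_twistIdeal`** — its instantiation at `𝔞γ := twistIdeal γ` under the Frobenius-reading guard of rows 37–38.

## References
* [Shimura1998] G. Shimura, *Abelian Varieties with Complex Multiplication and Modular Functions* (1998), §13.1 Thm. 1 (pp. 97–99), §18.6 (p. 127).
* [Liu2021] Y. Liu, *Fourier–Jacobi cycles and arithmetic relative trace formula*, Camb. J. Math. 9 (2021), Prop. D.8 (3) p. 135, pp. 136–138.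
* [Tate1997FiniteFlatGroupSchemes] J. Tate, *Finite flat group schemes* (1997), (3.7).
* [Neukirch1999] J. Neukirch, *Algebraic Number Theory* (1999), Ch. I §3 (3.6).
-/

set_option autoImplicit false

noncomputable section

namespace Summit.HodgeConjecture.HodgeConjecture.Cruxes.HLiu418.F0P6aRoofFrobKernelLawAssembly

set_option linter.dupNamespace false  -- `Summit.HodgeConjecture.HodgeConjecture.…` BY DESIGN (D-0017)

open CategoryTheory CategoryTheory.Limits AlgebraicGeometry NumberField IsDedekindDomain MulAction
open scoped Matrix Polynomial Pointwise MonoidalCategory MonObj Obj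
open Literature.NumberTheory.GaloisRepresentations
open Literature.NumberTheory.Automorphic Literature.NumberTheory.Automorphic.UnitaryGroup
open Literature.AlgebraicGeometry.ShimuraVarieties.UnitaryCanonicalModel
open Literature.NumberTheory.Automorphic.Liu2021.AppendixC
open Literature.AlgebraicGeometry.Motives (AlgPoints IntegralModel SchemeOver thickening relFrobeniusOver frobSpec)
open Literature.NumberTheory.DiophantineGeometry (geomResidueField specResidueField)
open Literature.AlgebraicGeometry.RelativeSpec (ActionOver)
open Literature.AlgebraicGeometry.AbelianSchemes Literature.AlgebraicGeometry.AbelianSchemes.AbelianSchemeOver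
open Summit.HodgeConjecture.HodgeConjecture.Cruxes.HLiu418.F0P6aModuliDatumDefs
open Summit.HodgeConjecture.HodgeConjecture.Cruxes.HLiu418.F0P6aRGDAssembly

/-! ### §1 Dedekind side conditions -/

section Dedekind

variable {F : Type} [Field F] [NumberField F]

/-- Distinct nonzero primes of `𝓞 F` are comaximal: `𝔭_u ⊔ 𝔭_v = ⊤` for `u ≠ v`. [cite: Neukirch1999, Ch. I §3 (3.6)] -/
theorem asIdeal_sup_asIdeal_eq_top {u v : HeightOneSpectrum (𝓞 F)} (h : u ≠ v) : u.asIdeal ⊔ v.asIdeal = ⊤ :=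
  Ideal.IsMaximal.coprime_of_ne u.isMaximal v.isMaximal fun h' => h (HeightOneSpectrum.ext h')

/-- **`𝔠·𝔭_w = 𝔞 ⇒ 𝔠 ⊔ 𝔭_u^n = 𝔞 ⊔ 𝔭_u^n` for `u ≠ w`** (the co-ideal and the twist ideal have the same `u`-part off `w`; Mathlib `Ideal.sup_mul_eq_of_coprime_right`) — the
`h𝔠𝔞` input of ★ `blockLaw_of_idealTorsionLaw` for `𝔠 := frobIdealOf 𝔞 w γ` (★ `frobIdealOf_mul_eq`). [cite: Neukirch1999, Ch. I §3 (3.6)] -/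
theorem sup_pow_asIdeal_eq_of_mul_asIdeal_eq {𝔠 𝔞 : Ideal (𝓞 F)} {w u : HeightOneSpectrum (𝓞 F)} (h : 𝔠 * w.asIdeal = 𝔞) (huw : u ≠ w) (n : ℕ) :
    𝔠 ⊔ u.asIdeal ^ n = 𝔞 ⊔ u.asIdeal ^ n := by
  rw [← h, sup_comm, sup_comm (a := 𝔠 * w.asIdeal)]
  exact (Ideal.sup_mul_eq_of_coprime_right (Ideal.pow_sup_eq_top (asIdeal_sup_asIdeal_eq_top huw))).symm

/-- **`𝔭_u^n ⊔ 𝔭_v^a · 𝔭_{v′}^b = ⊤` for `u ∉ {v, v′}`** — the `hcop` input of ★ `blockLaw_of_idealTorsionLaw` for a kernel bound `𝔭` supported on `{w, c•w}`.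
[cite: Neukirch1999, Ch. I §3 (3.6)] -/
theorem pow_asIdeal_sup_mul_eq_top {u v v' : HeightOneSpectrum (𝓞 F)} (huv : u ≠ v) (huv' : u ≠ v') (n a b : ℕ) :
    u.asIdeal ^ n ⊔ v.asIdeal ^ a * v'.asIdeal ^ b = ⊤ := by
  have hv : u.asIdeal ^ n ⊔ v.asIdeal ^ a = ⊤ := Ideal.pow_sup_pow_eq_top (asIdeal_sup_asIdeal_eq_top huv)
  have hv' : u.asIdeal ^ n ⊔ v'.asIdeal ^ b = ⊤ := Ideal.pow_sup_pow_eq_top (asIdeal_sup_asIdeal_eq_top huv')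
  rw [Ideal.sup_mul_eq_of_coprime_left hv]
  exact hv'

/-- `𝔭_u^n ⊔ 𝔭_v · 𝔭_{v′} = ⊤` for `u ∉ {v, v′}` (the `hcop` input for `𝔭 := 𝔭_w · 𝔭_{c•w}`). [cite: Neukirch1999, Ch. I §3 (3.6)] -/
theorem pow_asIdeal_sup_asIdeal_mul_asIdeal_eq_top {u v v' : HeightOneSpectrum (𝓞 F)} (huv : u ≠ v) (huv' : u ≠ v') (n : ℕ) :
    u.asIdeal ^ n ⊔ v.asIdeal * v'.asIdeal = ⊤ := by
  simpa only [pow_one] using pow_asIdeal_sup_mul_eq_top huv huv' n 1 1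

omit [NumberField F] in
/-- **THE `hq` NUMEROLOGY OF THE ALL-`T` ASSEMBLY: `n ∈ 𝔠 · (𝔭_w · g•𝔭_w)`** whenever `𝔠·𝔭_w = 𝔞`, `(n) = 𝔞 · g•𝔞` and `𝔭_w ∣ 𝔞` (for a ring automorphism `g`, e.g. complex
conjugation): `𝔞 ≤ 𝔭_w` gives `g•𝔞 ≤ g•𝔭_w = 𝔭_{g•w}`, so `(n) = 𝔞 · g•𝔞 ≤ 𝔞 · 𝔭_{g•w} = 𝔠 · 𝔭_w · 𝔭_{g•w}` — the input `hq : (q : 𝓞 F) ∈ 𝔠 * 𝔭` of ★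
`comp_relFrobeniusOver_eq_one_iff_of_torsion_blocks` with `𝔭 := 𝔭_w · 𝔭_{c•w}` (LA3-plan (g2) «M-69»: `Ker q̄ ≤ A_x̄[𝔭_w 𝔭_{c•w}]`), fed at x̄ by the spine rows `twistNorm_spec`,
`twistNorm_frob`, `twistIdeal_frob` and ★ `frobIdealOf_mul_eq`. [cite: Shimura1998, §13.1 Thm. 1 (pp. 97–99)] [cite: Neukirch1999, Ch. I §3 (3.6)] -/
theorem natCast_mem_mul_asIdeal_mul_smul_asIdeal {G : Type*} [Group G] [MulSemiringAction G F]
    (g : G) {𝔠 𝔞 : Ideal (𝓞 F)} {w : HeightOneSpectrum (𝓞 F)} {n : ℕ}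
    (h𝔠 : 𝔠 * w.asIdeal = 𝔞) (hspec : Ideal.span {((n : ℕ) : 𝓞 F)} = 𝔞 * g • 𝔞) (hdiv : w.asIdeal ∣ 𝔞) :
    ((n : ℕ) : 𝓞 F) ∈ 𝔠 * (w.asIdeal * (g • w).asIdeal) := by
  have hn : ((n : ℕ) : 𝓞 F) ∈ 𝔞 * g • 𝔞 := hspec ▸ Ideal.mem_span_singleton_self _
  have hle : g • 𝔞 ≤ g • w.asIdeal := Ideal.pointwise_smul_le_pointwise_smul_iff.2 (Ideal.le_of_dvd hdiv)
  have h : 𝔞 * g • 𝔞 ≤ 𝔠 * (w.asIdeal * (g • w).asIdeal) := by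
    rw [← mul_assoc, h𝔠]
    exact Ideal.mul_mono_right hle
  exact h hn

omit [NumberField F] in
/-- **`hq` FROM THE LEAF'S TOKENS** (`stub_ROOFGEO` ∕ `stub_ROOF0` binders `_hspec γ : (𝔫 γ) = 𝔞 γ · c•𝔞 γ`, `_hnorm σ hσ γ hγ : 𝔫 γ = p^f`, `_hdiv σ hσ γ hγ : 𝔭_w ∣ 𝔞 γ` and
★ `frobIdealOf_mul_eq : 𝔠 · 𝔭_w = 𝔞 γ`): `(p^f : 𝓞 F) ∈ 𝔠 · (𝔭_w · 𝔭_{g•w})` — `natCast_mem_mul_asIdeal_mul_smul_asIdeal` after `𝔫γ = p^f`; the `hq` input of §3 `hL_sch₀Of`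
(★ `comp_relFrobeniusOver_eq_one_iff_of_torsion_blocks` at `q := p^f`, `𝔭 := 𝔭_w·𝔭_{c•w}`, LA3-plan (g2) «M-69»). [cite: Shimura1998, §13.1 Thm. 1 (pp. 97–99)] [cite: Neukirch1999, Ch. I §3 (3.6)] -/
theorem hq_of_norm_spec {G : Type*} [Group G] [MulSemiringAction G F]
    (g : G) {𝔞γ 𝔠 : Ideal (𝓞 F)} {w : HeightOneSpectrum (𝓞 F)} {p f 𝔫γ : ℕ}
    (h𝔠 : 𝔠 * w.asIdeal = 𝔞γ) (hspec : Ideal.span {((𝔫γ : ℕ) : 𝓞 F)} = 𝔞γ * g • 𝔞γ) (hnorm : 𝔫γ = p ^ f) (hdiv : w.asIdeal ∣ 𝔞γ) :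
    ((p ^ f : ℕ) : 𝓞 F) ∈ 𝔠 * (w.asIdeal * (g • w).asIdeal) := by
  subst hnorm
  exact natCast_mem_mul_asIdeal_mul_smul_asIdeal g h𝔠 hspec hdiv

end Dedekind

/-! ### §2 The banal per-block law at `A_{red₀ y}` -/

section Banal

variable {F : Type} [Field F] [NumberField F] [IsCMField F] {ι₁ : F →+* ℂ}
    {Jstar : Matrix (Fin 2) (Fin 2) F}
    {K₀ : C5.OpenCompactSubgroup ↥(finAdelic ↥(maximalRealSubfield F) F (IsCMField.complexConj F) 2 Jstar)}
    {S : RecordSystemGS F Jstar ι₁ K₀} {hU7ₛ : S.HeckeTranslateDefinedOver}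
    {hJ : (Jstar.map (IsCMField.complexConj F))ᵀ = Jstar} {hJu : IsUnit Jstar}
    {Fi : Type} [Field Fi] [Algebra F Fi] {Kc : C5.SmallLevel K₀} {G : Type} [Group G]
    {𝓜 : IntegralModel (𝓞 F) F ((thickening F Fi).obj (S.M.obj Kc))}
    {w : HeightOneSpectrum (𝓞 F)} {hw : (IsCMField.complexConj F) • w ≠ w} {h𝓨 : (𝓜.localise w).IsSmoothProper 1}
    {θ : ActionOver (𝓜.localise w).total.hom ((Fi ≃ₐ[F] Fi) × G)}
    {e : Fi →ₐ[F] AlgebraicClosure (w.adicCompletion F)}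

/-- **THE BANAL PER-BLOCK `law` OF ★ `comp_relFrobeniusOver_eq_one_iff_of_torsion_blocks` AT `A_{red₀ y}`** — token shape of its `law` binder at one index: for `I : RGDInputsAt …`, an
ideal `𝔞γ` carrying the banal-block Frobenius-kernel law `hban : FrobKernelBanal₀ … 𝔞γ` (the leaf's `(_hpin σ hσ γ hγ).2`; row 38 at `twistIdeal γ`), a record point `y`, a banal
place `u ∣ p` off `{w, c•w}`, an exponent `n`, the action `act` on
`A := sch₀Of 𝓜 w I.univ (red₀ y)` IN THE ASSEMBLY'S CURRENCY (`act : RingAction (𝓞 F) A`; the consumer passes `(I.act.baseChange ι_s).baseChange x̄.left` with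
`hact := fun _ => rfl`, ★ `act₀Of_hom_hom_hom`), ANY leg `q̄ : A → Y` with kernel bound `Ker q̄ ⊆ A[𝔭]` (`𝔭` prime to `𝔭_u^n`), ANY co-ideal `𝔠` with
`𝔠 ⊔ 𝔭_u^n = 𝔞_γ ⊔ 𝔭_u^n` (§1 for `𝔠·𝔭_w = 𝔞_γ`) and an idempotent `e_u` absorbed by `𝔭_u^n` modulo `q = p^f` (★ `exists_crtIdempotentFamily_span_singleton`): every `q`-torsion
`T`-point `x` fixed by `ι(e_u)` satisfies `x ≫ F_q = 1 ↔ ∀ a ∈ 𝔠, x ≫ ι(a) ≫ q̄ = 1` — ★ `blockLaw_of_idealTorsionLaw` over the `𝔭_u^n`-torsion law `hban` (read through `hact`). [cite: Shimura1998, §13.1 Thm. 1 (pp. 97–99) and §18.6 (p. 127)] [cite: Liu2021, Prop. D.8 (3) pp. 136–138] [cite: Tate1997FiniteFlatGroupSchemes, (3.7)] -/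
theorem banalBlockLaw_sch₀Of (I : RGDInputsAt F ι₁ Jstar K₀ S hU7ₛ hJ hJu Fi Kc G 𝓜 w hw h𝓨 θ e) [ExpChar (geomResidueField w) I.pChar]
    (𝔞γ : Ideal (𝓞 F)) (hban : FrobKernelBanal₀ S Kc 𝓜 w h𝓨 e I.univ I.act I.pChar I.fDeg 𝔞γ)
    (y : AlgPoints (S.M.obj Kc) (AlgebraicClosure (w.adicCompletion F)))
    (u : HeightOneSpectrum (𝓞 F)) (hpu : (I.pChar : 𝓞 F) ∈ u.asIdeal) (huw : u ≠ w) (hucw : u ≠ (IsCMField.complexConj F) • w) (n : ℕ)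
    (act : AbelianSchemeOver.RingAction (𝓞 F) (sch₀Of 𝓜 w I.univ (red₀Of S Kc 𝓜 w h𝓨 e y)))
    (hact : ∀ a : 𝓞 F, act.i a = (act₀Of 𝓜 w I.univ I.act a (red₀Of S Kc 𝓜 w h𝓨 e y)).hom.hom.hom)
    {Y : SchemeOver (geomResidueField w)} [GrpObj Y] (qbar : (sch₀Of 𝓜 w I.univ (red₀Of S Kc 𝓜 w h𝓨 e y)).X ⟶ Y) [IsMonHom qbar]
    (𝔠 𝔭 : Ideal (𝓞 F)) {eu : 𝓞 F}
    (h𝔟e : ∀ b ∈ u.asIdeal ^ n, b * eu ∈ Ideal.span {((I.pChar ^ I.fDeg : ℕ) : 𝓞 F)})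
    (hcop : u.asIdeal ^ n ⊔ 𝔭 = ⊤) (h𝔠𝔞 : 𝔠 ⊔ u.asIdeal ^ n = 𝔞γ ⊔ u.asIdeal ^ n)
    (hker : ∀ ⦃T : SchemeOver (geomResidueField w)⦄ (z : T ⟶ (sch₀Of 𝓜 w I.univ (red₀Of S Kc 𝓜 w h𝓨 e y)).X), z ≫ qbar = 1 →
      ∀ b ∈ 𝔭, z ≫ act.i b = 1)
    ⦃T : SchemeOver (geomResidueField w)⦄ (x : T ⟶ (sch₀Of 𝓜 w I.univ (red₀Of S Kc 𝓜 w h𝓨 e y)).X)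
    (hxN : x ≫ (sch₀Of 𝓜 w I.univ (red₀Of S Kc 𝓜 w h𝓨 e y)).mulN (I.pChar ^ I.fDeg) = 1) (hxe : x ≫ act.i eu = x) :
    (x ≫ relFrobeniusOver I.pChar I.fDeg (sch₀Of 𝓜 w I.univ (red₀Of S Kc 𝓜 w h𝓨 e y)).X =
        (1 : T ⟶ ((sch₀Of 𝓜 w I.univ (red₀Of S Kc 𝓜 w h𝓨 e y)).baseChange (frobSpec (geomResidueField w) I.pChar I.fDeg)).X)) ↔
      ∀ a ∈ 𝔠, x ≫ act.i a ≫ qbar = 1 := by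
  -- row 38 read through `hact`: the `𝔭_u^n`-torsion law in the assembly's currency
  have hban : ∀ ⦃T' : SchemeOver (geomResidueField w)⦄ (x' : T' ⟶ (sch₀Of 𝓜 w I.univ (red₀Of S Kc 𝓜 w h𝓨 e y)).X),
      (∀ b ∈ u.asIdeal ^ n, x' ≫ act.i b = 1) →
      ((x' ≫ relFrobeniusOver I.pChar I.fDeg (sch₀Of 𝓜 w I.univ (red₀Of S Kc 𝓜 w h𝓨 e y)).X =
          (1 : T' ⟶ ((sch₀Of 𝓜 w I.univ (red₀Of S Kc 𝓜 w h𝓨 e y)).baseChange (frobSpec (geomResidueField w) I.pChar I.fDeg)).X)) ↔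
        ∀ a ∈ 𝔞γ, x' ≫ act.i a = 1) := by
    intro T' x' hx'
    have h := hban y u hpu huw hucw n x' (fun b hb => by rw [← hact]; exact hx' b hb)
    refine h.trans (forall₂_congr fun a _ => ?_)
    rw [← hact a]
    exact Iff.rfl
  set_option backward.isDefEq.respectTransparency false in
  exact blockLaw_of_idealTorsionLaw I.pChar I.fDeg act qbar 𝔠 𝔭 (u.asIdeal ^ n) 𝔞γ h𝔟e hcop h𝔠𝔞 hker hban x hxN hxe

/-- **`hq` AT x̄ FROM THE SPINE ROWS**: for a Frobenius reading `(σ, γ)` and any co-ideal `𝔠` with `𝔠 · 𝔭_w = 𝔞_γ` (★ `frobIdealOf_mul_eq`),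
`(p^f : 𝓞 F) ∈ 𝔠 · (𝔭_w · 𝔭_{c•w})` — rows `I.twistNorm_spec γ`, `I.twistNorm_frob σ hσ γ hγ`, `I.twistIdeal_frob σ hσ γ hγ` through §1
`natCast_mem_mul_asIdeal_mul_smul_asIdeal`; the `hq` input of ★ `comp_relFrobeniusOver_eq_one_iff_of_torsion_blocks` at `q := p^f`, `𝔭 := 𝔭_w·𝔭_{c•w}`.
[cite: Shimura1998, §13.1 Thm. 1 (pp. 97–99) and §18.6 (p. 127)] -/
theorem hq_sch₀Of (I : RGDInputsAt F ι₁ Jstar K₀ S hU7ₛ hJ hJu Fi Kc G 𝓜 w hw h𝓨 θ e)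
    (σ : Field.absoluteGaloisGroup (w.adicCompletion F)) (hσ : IsAbsArithFrob σ) (gam : Fi ≃ₐ[F] Fi)
    (hγ : ((AlgEquiv.restrictScalars F (Field.absoluteGaloisGroup.toAlgEquiv (w.adicCompletion F) σ) :
        AlgebraicClosure (w.adicCompletion F) ≃ₐ[F] AlgebraicClosure (w.adicCompletion F)) :
        AlgebraicClosure (w.adicCompletion F) →ₐ[F] AlgebraicClosure (w.adicCompletion F)).comp e = e.comp (gam : Fi →ₐ[F] Fi))
    {𝔠 : Ideal (𝓞 F)} (h𝔠 : 𝔠 * w.asIdeal = I.twistIdeal gam) :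
    ((I.pChar ^ I.fDeg : ℕ) : 𝓞 F) ∈ 𝔠 * (w.asIdeal * ((IsCMField.complexConj F) • w).asIdeal) := by
  rw [← I.twistNorm_frob σ hσ gam hγ]
  exact natCast_mem_mul_asIdeal_mul_smul_asIdeal (IsCMField.complexConj F) h𝔠 (I.twistNorm_spec gam) (I.twistIdeal_frob σ hσ gam hγ)

/-! ### §3 THE ASSEMBLY AT x̄: the (rL) row of `Roof₀` from the kernel bound and the two `p`-adic block laws -/

/-- **(rL-asm) AT x̄ — THE FROBENIUS-KERNEL LAW «`t ≫ F_q = 1 ↔ ∀ a ∈ 𝔠, t ≫ ι(a) ≫ q̄ = 1`» ON ALL `T`-POINTS OF `A_{red₀ y}` FROM THREE NAMED INPUTS** (= the `hL` row of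
`roof₀_of_rows` ∕ `Roof₀` (rL) after the `rfl`-bridge `hact`): ★ p848378 `comp_relFrobeniusOver_eq_one_iff_of_torsion_blocks` at `q := p^f`, `𝔭 := 𝔭_w · 𝔭_{c•w}`
(LA3-plan (g2) «M-69»), the CRT idempotent family of the primes over `p` (★ p849638, a DATUM `e` with its Kronecker clauses so that every supplier reads the same family),
`hq : (p^f) ∈ 𝔠·𝔭_w·𝔭_{c•w}` (§2 `hq_of_norm_spec` from the leaf's tokens ∕ `hq_sch₀Of` from the spine rows), and the per-block `law`s: EVERY BANAL index discharged here by §2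
`banalBlockLaw_sch₀Of` over `hban : FrobKernelBanal₀ … 𝔞γ` (the leaf's `(_hpin σ hσ γ hγ).2`, `𝔠·𝔭_w = 𝔞γ` = ★ `frobIdealOf_mul_eq (_hdiv …)`), the TWO `p`-adic indices `w`, `c•w`
taken as INPUTS `hlaw_w`, `hlaw_cw` in the idempotent-free «`𝔭_v^n`-primary `q`-torsion point» shape of `FrobKernelBanal₀` with the (rL) right-hand side (A-p03 (R3) ∕
LA3-p03–F0P6b (R2)), and the kernel bound `hker` (LA1-p04 (hker-DOWN)) — all three in Defs `act₀Of` currency, converted inside by `hact`.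
[cite: Liu2021, Prop. D.8 (3) p. 135, pp. 136–138] [cite: Shimura1998, §13.1 Thm. 1 (pp. 97–99)] [cite: Tate1997FiniteFlatGroupSchemes, (3.7)] [cite: Neukirch1999, Ch. I §3 (3.6)] -/
theorem hL_sch₀Of (I : RGDInputsAt F ι₁ Jstar K₀ S hU7ₛ hJ hJu Fi Kc G 𝓜 w hw h𝓨 θ e) [ExpChar (geomResidueField w) I.pChar]
    [PerfectField (geomResidueField w)] [Fact I.pChar.Prime] [CharP (geomResidueField w) I.pChar]
    -- the twist ideal `𝔞γ` with its banal-block law (the leaf's `(_hpin σ hσ γ hγ).2`; row 38 at `twistIdeal γ`)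
    (𝔞γ : Ideal (𝓞 F)) (hban : FrobKernelBanal₀ S Kc 𝓜 w h𝓨 e I.univ I.act I.pChar I.fDeg 𝔞γ)
    (y : AlgPoints (S.M.obj Kc) (AlgebraicClosure (w.adicCompletion F)))
    (act : AbelianSchemeOver.RingAction (𝓞 F) (sch₀Of 𝓜 w I.univ (red₀Of S Kc 𝓜 w h𝓨 e y)))
    (hact : ∀ a : 𝓞 F, act.i a = (act₀Of 𝓜 w I.univ I.act a (red₀Of S Kc 𝓜 w h𝓨 e y)).hom.hom.hom)
    {Y : SchemeOver (geomResidueField w)} [GrpObj Y] (qbar : (sch₀Of 𝓜 w I.univ (red₀Of S Kc 𝓜 w h𝓨 e y)).X ⟶ Y) [IsMonHom qbar]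
    -- the co-ideal `𝔠 = 𝔞γ 𝔭_w⁻¹` (★ `frobIdealOf_mul_eq`) and the `hq` numerology (§2 `hq_of_norm_spec` ∕ `hq_sch₀Of`)
    {𝔠 : Ideal (𝓞 F)} (h𝔠 : 𝔠 * w.asIdeal = 𝔞γ)
    (hq : ((I.pChar ^ I.fDeg : ℕ) : 𝓞 F) ∈ 𝔠 * (w.asIdeal * ((IsCMField.complexConj F) • w).asIdeal))
    -- the CRT idempotent family of `(q) = (p^f)` indexed by its prime factors (★ `exists_crtIdempotentFamily_span_singleton`)
    [DecidableEq (Ideal (𝓞 F))] (ε : Ideal (𝓞 F) → 𝓞 F)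
    (hε1 : ∀ P ∈ (UniqueFactorizationMonoid.normalizedFactors (Ideal.span {((I.pChar ^ I.fDeg : ℕ) : 𝓞 F)})).toFinset,
      ε P - 1 ∈ P ^ (UniqueFactorizationMonoid.normalizedFactors (Ideal.span {((I.pChar ^ I.fDeg : ℕ) : 𝓞 F)})).count P)
    (hε0 : ∀ P ∈ (UniqueFactorizationMonoid.normalizedFactors (Ideal.span {((I.pChar ^ I.fDeg : ℕ) : 𝓞 F)})).toFinset,
      ∀ P' ∈ (UniqueFactorizationMonoid.normalizedFactors (Ideal.span {((I.pChar ^ I.fDeg : ℕ) : 𝓞 F)})).toFinset, P' ≠ P →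
        ε P ∈ P' ^ (UniqueFactorizationMonoid.normalizedFactors (Ideal.span {((I.pChar ^ I.fDeg : ℕ) : 𝓞 F)})).count P')
    -- (hker-DOWN): the kernel bound `Ker q̄ ⊆ A_x̄[𝔭_w·𝔭_{c•w}]` (LA1-p04)
    (hker : ∀ ⦃T : SchemeOver (geomResidueField w)⦄ (z : T ⟶ (sch₀Of 𝓜 w I.univ (red₀Of S Kc 𝓜 w h𝓨 e y)).X), z ≫ qbar = 1 →
      ∀ b ∈ w.asIdeal * ((IsCMField.complexConj F) • w).asIdeal, z ≫ (act₀Of 𝓜 w I.univ I.act b (red₀Of S Kc 𝓜 w h𝓨 e y)).hom.hom.hom = 1)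
    -- (R2)∕(R3): the `w`- and `c•w`-block laws on `𝔭_v^n`-primary `q`-torsion points
    (hlaw : ∀ v : HeightOneSpectrum (𝓞 F), v = w ∨ v = (IsCMField.complexConj F) • w →
      ∀ (n : ℕ) ⦃T : SchemeOver (geomResidueField w)⦄ (x : T ⟶ (sch₀Of 𝓜 w I.univ (red₀Of S Kc 𝓜 w h𝓨 e y)).X),
      x ≫ (sch₀Of 𝓜 w I.univ (red₀Of S Kc 𝓜 w h𝓨 e y)).mulN (I.pChar ^ I.fDeg) = 1 →
      (∀ b ∈ v.asIdeal ^ n, x ≫ (act₀Of 𝓜 w I.univ I.act b (red₀Of S Kc 𝓜 w h𝓨 e y)).hom.hom.hom = 1) →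
      ((x ≫ relFrobeniusOver I.pChar I.fDeg (sch₀Of 𝓜 w I.univ (red₀Of S Kc 𝓜 w h𝓨 e y)).X =
          (1 : T ⟶ ((sch₀Of 𝓜 w I.univ (red₀Of S Kc 𝓜 w h𝓨 e y)).baseChange (frobSpec (geomResidueField w) I.pChar I.fDeg)).X)) ↔
        ∀ a ∈ 𝔠, x ≫ (act₀Of 𝓜 w I.univ I.act a (red₀Of S Kc 𝓜 w h𝓨 e y)).hom.hom.hom ≫ qbar = 1))
    ⦃T : SchemeOver (geomResidueField w)⦄ (t : T ⟶ (sch₀Of 𝓜 w I.univ (red₀Of S Kc 𝓜 w h𝓨 e y)).X) :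
    (t ≫ relFrobeniusOver I.pChar I.fDeg (sch₀Of 𝓜 w I.univ (red₀Of S Kc 𝓜 w h𝓨 e y)).X =
        (1 : T ⟶ ((sch₀Of 𝓜 w I.univ (red₀Of S Kc 𝓜 w h𝓨 e y)).baseChange (frobSpec (geomResidueField w) I.pChar I.fDeg)).X)) ↔
      ∀ a ∈ 𝔠, t ≫ act.i a ≫ qbar = 1 := by
  -- (0) notation and the factorisation of `(q)`
  have hq0 : ((I.pChar ^ I.fDeg : ℕ) : 𝓞 F) ≠ 0 := by exact_mod_cast pow_ne_zero _ I.hpChar.1.ne_zero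
  have hI0 : Ideal.span {((I.pChar ^ I.fDeg : ℕ) : 𝓞 F)} ≠ ⊥ := by rwa [Ne, Ideal.span_singleton_eq_bot]
  have hprime : ∀ P ∈ (UniqueFactorizationMonoid.normalizedFactors (Ideal.span {((I.pChar ^ I.fDeg : ℕ) : 𝓞 F)})).toFinset,
      Prime ((fun P : Ideal (𝓞 F) => P) P) := fun P hP =>
    UniqueFactorizationMonoid.prime_of_normalized_factor P (Multiset.mem_toFinset.mp hP)
  have hne : ∀ᵉ (P ∈ (UniqueFactorizationMonoid.normalizedFactors (Ideal.span {((I.pChar ^ I.fDeg : ℕ) : 𝓞 F)})).toFinset)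
      (P' ∈ (UniqueFactorizationMonoid.normalizedFactors (Ideal.span {((I.pChar ^ I.fDeg : ℕ) : 𝓞 F)})).toFinset),
      P ≠ P' → (fun P : Ideal (𝓞 F) => P) P ≠ P' := fun _ _ _ _ h => h
  have hfac := Literature.RingTheory.DedekindDomain.prod_toFinset_normalizedFactors_pow_count hI0
  -- (1) `hsum`, `hidem`, absorption from the Kronecker clauses (★ p849638 §2)
  have hsum := Literature.RingTheory.DedekindDomain.sum_sub_one_mem_prod_pow hprime hne hε1 hε0
  rw [hfac] at hsum
  have hidem : ∀ P ∈ (UniqueFactorizationMonoid.normalizedFactors (Ideal.span {((I.pChar ^ I.fDeg : ℕ) : 𝓞 F)})).toFinset,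
      ε P * ε P - ε P ∈ Ideal.span {((I.pChar ^ I.fDeg : ℕ) : 𝓞 F)} := fun P hP => by
    have h := Literature.RingTheory.DedekindDomain.mul_self_sub_mem_prod_pow hprime hne hε1 hε0 hP
    rwa [hfac] at h
  have habs : ∀ P ∈ (UniqueFactorizationMonoid.normalizedFactors (Ideal.span {((I.pChar ^ I.fDeg : ℕ) : 𝓞 F)})).toFinset,
      ∀ b ∈ P ^ (UniqueFactorizationMonoid.normalizedFactors (Ideal.span {((I.pChar ^ I.fDeg : ℕ) : 𝓞 F)})).count P,
        b * ε P ∈ Ideal.span {((I.pChar ^ I.fDeg : ℕ) : 𝓞 F)} := fun P hP b hb => by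
    have h := Literature.RingTheory.DedekindDomain.mul_mem_prod_pow_of_mem_pow hprime hne hε0 hP hb
    rwa [hfac] at h
  -- (2) `hker` in the assembly's currency
  have hker' : ∀ ⦃T : SchemeOver (geomResidueField w)⦄ (z : T ⟶ (sch₀Of 𝓜 w I.univ (red₀Of S Kc 𝓜 w h𝓨 e y)).X), z ≫ qbar = 1 →
      ∀ b ∈ w.asIdeal * ((IsCMField.complexConj F) • w).asIdeal, z ≫ act.i b = 1 := fun T z hz b hb => by
    rw [hact]
    exact hker z hz b hb
  -- (3) the assembly
  refine comp_relFrobeniusOver_eq_one_iff_of_torsion_blocks I.pChar I.fDeg (sch₀Of 𝓜 w I.univ (red₀Of S Kc 𝓜 w h𝓨 e y)) act qbar 𝔠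
    (UniqueFactorizationMonoid.normalizedFactors (Ideal.span {((I.pChar ^ I.fDeg : ℕ) : 𝓞 F)})).toFinset ε
    (w.asIdeal * ((IsCMField.complexConj F) • w).asIdeal) hq hker' hsum hidem (fun P hP T x hxN hxe => ?_) t
  -- (4) the per-block law at the prime `P ∣ (q)`: `x` is `P^{v_P(q)}`-primary
  have hprim : ∀ b ∈ P ^ (UniqueFactorizationMonoid.normalizedFactors (Ideal.span {((I.pChar ^ I.fDeg : ℕ) : 𝓞 F)})).count P, x ≫ act.i b = 1 :=
    act.forall_comp_i_eq_one_of_mul_mem_span x hxN hxe (habs P hP)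
  have hPprime : Prime P := hprime P hP
  have hP0 : P ≠ ⊥ := hPprime.ne_zero
  -- `P` as a place `u`, and `p ∈ P`
  let u : HeightOneSpectrum (𝓞 F) := ⟨P, Ideal.isPrime_of_prime hPprime, hP0⟩
  have huP : u.asIdeal = P := rfl
  have hqP : ((I.pChar ^ I.fDeg : ℕ) : 𝓞 F) ∈ P := by
    have hdvd : P ∣ Ideal.span {((I.pChar ^ I.fDeg : ℕ) : 𝓞 F)} :=
      UniqueFactorizationMonoid.dvd_of_mem_normalizedFactors (Multiset.mem_toFinset.mp hP)
    exact (Ideal.dvd_span_singleton.mp hdvd)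
  have hpP : (I.pChar : 𝓞 F) ∈ P := by
    rw [Nat.cast_pow] at hqP
    exact (Ideal.isPrime_of_prime hPprime).mem_of_pow_mem _ hqP
  by_cases hPw : u = w
  · -- the `w`-block
    have hPeq : P = w.asIdeal := by rw [← huP, hPw]
    have h := hlaw w (Or.inl rfl) ((UniqueFactorizationMonoid.normalizedFactors (Ideal.span {((I.pChar ^ I.fDeg : ℕ) : 𝓞 F)})).count P) x hxN
      (fun b hb => by
        rw [← hact]
        refine hprim b ?_
        rw [hPeq] at hb ⊢
        exact hb)
    refine h.trans (forall₂_congr fun a _ => ?_)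
    rw [hact a]
    exact Iff.rfl
  · by_cases hPcw : u = (IsCMField.complexConj F) • w
    · -- the `c•w`-block
      have hPeq : P = ((IsCMField.complexConj F) • w).asIdeal := by rw [← huP, hPcw]
      have h := hlaw ((IsCMField.complexConj F) • w) (Or.inr rfl)
        ((UniqueFactorizationMonoid.normalizedFactors (Ideal.span {((I.pChar ^ I.fDeg : ℕ) : 𝓞 F)})).count P) x hxN
        (fun b hb => by
          rw [← hact]
          refine hprim b ?_
          rw [hPeq] at hb ⊢
          exact hb)
      refine h.trans (forall₂_congr fun a _ => ?_)
      rw [hact a]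
      exact Iff.rfl
    · -- a banal block: row 38
      have hcop : u.asIdeal ^ (UniqueFactorizationMonoid.normalizedFactors (Ideal.span {((I.pChar ^ I.fDeg : ℕ) : 𝓞 F)})).count P ⊔
          w.asIdeal * ((IsCMField.complexConj F) • w).asIdeal = ⊤ :=
        pow_asIdeal_sup_asIdeal_mul_asIdeal_eq_top hPw hPcw _
      exact banalBlockLaw_sch₀Of I 𝔞γ hban y u hpP hPw hPcw _ act hact qbar 𝔠 (w.asIdeal * ((IsCMField.complexConj F) • w).asIdeal)
        (habs P hP) hcop (sup_pow_asIdeal_eq_of_mul_asIdeal_eq h𝔠 hPw _) hker' x hxN hxe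

/-- **(rL-asm) AT x̄ AT THE SPINE'S TWIST IDEAL** — §3 `hL_sch₀Of` instantiated at `𝔞γ := I.twistIdeal γ` under the Frobenius-reading guard `(σ, γ)` of spine rows 37–38 VERBATIM:
`hban := I.frobKernel_banal σ hσ γ hγ` (row 38) and `hq := hq_sch₀Of …` (rows `twistNorm_spec`∕`twistNorm_frob`∕`twistIdeal_frob`); the remaining inputs as in `hL_sch₀Of`.
[cite: Liu2021, Prop. D.8 (3) p. 135, pp. 136–138] [cite: Shimura1998, §13.1 Thm. 1 (pp. 97–99) and §18.6 (p. 127)] -/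
theorem hL_sch₀Of_twistIdeal (I : RGDInputsAt F ι₁ Jstar K₀ S hU7ₛ hJ hJu Fi Kc G 𝓜 w hw h𝓨 θ e) [ExpChar (geomResidueField w) I.pChar]
    [PerfectField (geomResidueField w)] [Fact I.pChar.Prime] [CharP (geomResidueField w) I.pChar]
    (σ : Field.absoluteGaloisGroup (w.adicCompletion F)) (hσ : IsAbsArithFrob σ) (gam : Fi ≃ₐ[F] Fi)
    (hγ : ((AlgEquiv.restrictScalars F (Field.absoluteGaloisGroup.toAlgEquiv (w.adicCompletion F) σ) :
        AlgebraicClosure (w.adicCompletion F) ≃ₐ[F] AlgebraicClosure (w.adicCompletion F)) :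
        AlgebraicClosure (w.adicCompletion F) →ₐ[F] AlgebraicClosure (w.adicCompletion F)).comp e = e.comp (gam : Fi →ₐ[F] Fi))
    (y : AlgPoints (S.M.obj Kc) (AlgebraicClosure (w.adicCompletion F)))
    (act : AbelianSchemeOver.RingAction (𝓞 F) (sch₀Of 𝓜 w I.univ (red₀Of S Kc 𝓜 w h𝓨 e y)))
    (hact : ∀ a : 𝓞 F, act.i a = (act₀Of 𝓜 w I.univ I.act a (red₀Of S Kc 𝓜 w h𝓨 e y)).hom.hom.hom)
    {Y : SchemeOver (geomResidueField w)} [GrpObj Y] (qbar : (sch₀Of 𝓜 w I.univ (red₀Of S Kc 𝓜 w h𝓨 e y)).X ⟶ Y) [IsMonHom qbar]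
    {𝔠 : Ideal (𝓞 F)} (h𝔠 : 𝔠 * w.asIdeal = I.twistIdeal gam)
    [DecidableEq (Ideal (𝓞 F))] (ε : Ideal (𝓞 F) → 𝓞 F)
    (hε1 : ∀ P ∈ (UniqueFactorizationMonoid.normalizedFactors (Ideal.span {((I.pChar ^ I.fDeg : ℕ) : 𝓞 F)})).toFinset,
      ε P - 1 ∈ P ^ (UniqueFactorizationMonoid.normalizedFactors (Ideal.span {((I.pChar ^ I.fDeg : ℕ) : 𝓞 F)})).count P)
    (hε0 : ∀ P ∈ (UniqueFactorizationMonoid.normalizedFactors (Ideal.span {((I.pChar ^ I.fDeg : ℕ) : 𝓞 F)})).toFinset,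
      ∀ P' ∈ (UniqueFactorizationMonoid.normalizedFactors (Ideal.span {((I.pChar ^ I.fDeg : ℕ) : 𝓞 F)})).toFinset, P' ≠ P →
        ε P ∈ P' ^ (UniqueFactorizationMonoid.normalizedFactors (Ideal.span {((I.pChar ^ I.fDeg : ℕ) : 𝓞 F)})).count P')
    (hker : ∀ ⦃T : SchemeOver (geomResidueField w)⦄ (z : T ⟶ (sch₀Of 𝓜 w I.univ (red₀Of S Kc 𝓜 w h𝓨 e y)).X), z ≫ qbar = 1 →
      ∀ b ∈ w.asIdeal * ((IsCMField.complexConj F) • w).asIdeal, z ≫ (act₀Of 𝓜 w I.univ I.act b (red₀Of S Kc 𝓜 w h𝓨 e y)).hom.hom.hom = 1)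
    (hlaw : ∀ v : HeightOneSpectrum (𝓞 F), v = w ∨ v = (IsCMField.complexConj F) • w →
      ∀ (n : ℕ) ⦃T : SchemeOver (geomResidueField w)⦄ (x : T ⟶ (sch₀Of 𝓜 w I.univ (red₀Of S Kc 𝓜 w h𝓨 e y)).X),
      x ≫ (sch₀Of 𝓜 w I.univ (red₀Of S Kc 𝓜 w h𝓨 e y)).mulN (I.pChar ^ I.fDeg) = 1 →
      (∀ b ∈ v.asIdeal ^ n, x ≫ (act₀Of 𝓜 w I.univ I.act b (red₀Of S Kc 𝓜 w h𝓨 e y)).hom.hom.hom = 1) →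
      ((x ≫ relFrobeniusOver I.pChar I.fDeg (sch₀Of 𝓜 w I.univ (red₀Of S Kc 𝓜 w h𝓨 e y)).X =
          (1 : T ⟶ ((sch₀Of 𝓜 w I.univ (red₀Of S Kc 𝓜 w h𝓨 e y)).baseChange (frobSpec (geomResidueField w) I.pChar I.fDeg)).X)) ↔
        ∀ a ∈ 𝔠, x ≫ (act₀Of 𝓜 w I.univ I.act a (red₀Of S Kc 𝓜 w h𝓨 e y)).hom.hom.hom ≫ qbar = 1))
    ⦃T : SchemeOver (geomResidueField w)⦄ (t : T ⟶ (sch₀Of 𝓜 w I.univ (red₀Of S Kc 𝓜 w h𝓨 e y)).X) :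
    (t ≫ relFrobeniusOver I.pChar I.fDeg (sch₀Of 𝓜 w I.univ (red₀Of S Kc 𝓜 w h𝓨 e y)).X =
        (1 : T ⟶ ((sch₀Of 𝓜 w I.univ (red₀Of S Kc 𝓜 w h𝓨 e y)).baseChange (frobSpec (geomResidueField w) I.pChar I.fDeg)).X)) ↔
      ∀ a ∈ 𝔠, t ≫ act.i a ≫ qbar = 1 :=
  hL_sch₀Of I (I.twistIdeal gam) (I.frobKernel_banal σ hσ gam hγ) y act hact qbar h𝔠 (hq_sch₀Of I σ hσ gam hγ h𝔠) ε hε1 hε0 hker hlaw t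

end Banal

end Summit.HodgeConjecture.HodgeConjecture.Cruxes.HLiu418.F0P6aRoofFrobKernelLawAssembly

end
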